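import Literature.Probability.LatticeModels.PolymerPressure
import HarnessLib

/-!
# Pushing a polymer gas forward along a support map; multiplicative set functions as polymer gases

Two pieces of exact combinatorics used to turn an expansion indexed by SETS OF INTERACTION
TERMS ("bonds", "cells") into a gas of SUBSET polymers of the lattice (Ueltschi 1999, §2.3:
"we group the sets `A₁,…,A_m` into connected components … we call `𝒜₁,…,𝒜_ℓ` polymers";
Friedli–Velenik §5.2–§5.7.1):

* `polymerPartitionFunction_pushforward`: if `s : P → Q` maps polymers to polymers so that
  polymers with the SAME image are incompatible (the fibres are cliques) and polymers with
  different images are incompatible iff their images are, then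
  `Ξ_B(w) = Ξ_{s(B)}(s_* w)` with the **pushforward activity**
  `(s_* w)(A) = Σ_{X ∈ B : s X = A} w X` (`pushforwardActivity`): compatible families of `B`
  correspond bijectively to compatible families of `s(B)` with a choice of one preimage per
  member. Proved by the one-polymer recursion `polymerPartitionFunction_insert` and strong
  induction on the volume.
* `eq_prod_rcomponents_of_forall_not_touches`: a set function `M` on finite cell sets with
  `M ∅ = 1` and `M (K₁ ∪ K₂) = M K₁ · M K₂` whenever `K₁, K₂` do not touch (no common or
  `R`-adjacent cells) is the product of its values on the `R`-components; hence
  (`sum_powerset_eq_polymerPartitionFunction_of_mul`, with the tree's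
  `sum_powerset_prod_rcomponents`) `Σ_{Q ⊆ P'} M Q` is the partition function of the gas of
  `R`-connected cell sets with activity `M` and the geometric incompatibility.
* Cells with vertex sets (`cellSupp`, `ShareVertex`): for cells `b` carrying nonempty finite
  vertex sets `verts b ⊆ α` and `R` = "sharing a vertex", the support map
  `K ↦ ⋃_{b ∈ K} verts b` satisfies the hypotheses of the pushforward from the gas of connected
  cell sets (geometric incompatibility) to the subset polymers of `α` with the meet-or-equal
  incompatibility `polyInc` (`polymerPartitionFunction_connected_eq_pushforward`), and the final
  regrouping `sum_powerset_eq_polymerPartitionFunction_cellSupp`: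
  `Σ_{Q ⊆ P'} M Q = Ξ^{polyInc}_{supports}(A ↦ Σ_{X connected, supp X = A} M X)`.

Everything is PROVED; no analytic input.

## Mathlib / tree search

Tree: `polymerPartitionFunction_insert` / `_eq_erase_add` (`PolymerGas`),
`polymerPartitionFunction_congr`, `polymerPartitionFunction_image` (injective relabelings only,
`ClusterExpansion`), `polymerPartitionFunction_eq_erase_of_eq_zero` (`ClusterExpansionActivityPaths`),
`rcomponents`, `isCompatible_rcomponents`, `biUnion_rcomponents`, `sum_powerset_prod_rcomponents`
(`PolymerGasGeometric`), `polyInc` (`PolymerPressure`). No pushforward along non-injective maps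
(`lean search 'pushforward.*polymer|polymerPartitionFunction_.*fib'`: nothing).

## References

* D. Ueltschi, J. Stat. Phys. 95 (1999) 693, §2.3 (grouping interaction sets into polymers).
  [Ueltschi1999]
* S. Friedli, Y. Velenik, *Statistical Mechanics of Lattice Systems* (CUP 2017), §5.2 and
  §5.7.1 (polymer representations). [FriedliVelenik2017]
-/

noncomputable section

namespace Literature.Probability.LatticeModels

open Finset
open scoped BigOperators

/-! ### Pushforward of a polymer gas along a support map -/

section Pushforward

variable {P Q : Type*} [DecidableEq P] [DecidableEq Q]
variable {inc : P → P → Prop} [DecidableRel inc] {inc' : Q → Q → Prop} [DecidableRel inc']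

/-- The **pushforward activity** of `w` along `s` from the volume `B`:
`(s_* w)(A) = Σ_{X ∈ B : s X = A} w X`. [cite: Ueltschi1999, §2.3 (the weight ρ(𝒜) sums over all families with union 𝒜)] -/
def pushforwardActivity (s : P → Q) (w : P → ℂ) (B : Finset P) : Q → ℂ :=
  fun A => ∑ X ∈ B.filter (fun X => s X = A), w X

omit [DecidableEq P] in
/-- `pushforwardActivity` unfolded. [folklore] -/
theorem pushforwardActivity_apply (s : P → Q) (w : P → ℂ) (B : Finset P) (A : Q) :
    pushforwardActivity s w B A = ∑ X ∈ B.filter (fun X => s X = A), w X := rfl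

omit [DecidableEq P] in
/-- The pushforward activity vanishes off the image of the volume. [folklore] -/
theorem pushforwardActivity_eq_zero_of_not_mem_image {s : P → Q} {w : P → ℂ} {B : Finset P} {A : Q}
    (hA : A ∉ B.image s) : pushforwardActivity s w B A = 0 := by
  rw [pushforwardActivity_apply]
  refine Finset.sum_eq_zero fun X hX => ?_
  obtain ⟨hXB, hXA⟩ := Finset.mem_filter.1 hX
  exact absurd (Finset.mem_image.2 ⟨X, hXB, hXA⟩) hA

/-- Adding one polymer to the volume adds its activity to the fibre of its image. [folklore] -/
theorem pushforwardActivity_insert (s : P → Q) (w : P → ℂ) {B : Finset P} {X₀ : P} (hX₀ : X₀ ∉ B) (A : Q) :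
    pushforwardActivity s w (insert X₀ B) A =
      pushforwardActivity s w B A + if A = s X₀ then w X₀ else 0 := by
  rw [pushforwardActivity_apply, pushforwardActivity_apply, Finset.filter_insert]
  by_cases h : s X₀ = A
  · rw [if_pos h, Finset.sum_insert (fun h' => hX₀ (Finset.mem_filter.1 h').1), if_pos h.symm, add_comm]
  · rw [if_neg h, if_neg (fun h' => h h'.symm), add_zero]

/-- **The partition function is affine in each activity**: changing the activity of a member
`A₀` of the volume by `c` changes `Ξ` by `c · Ξ(polymers compatible with A₀)`.
[cite: FernandezProcacci2007, §2] -/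
theorem polymerPartitionFunction_add_single [Std.Refl inc'] [Std.Symm inc'] (ρ : Q → ℂ) (c : ℂ)
    {𝒱 : Finset Q} {A₀ : Q} (hA₀ : A₀ ∈ 𝒱) :
    polymerPartitionFunction inc' (fun A => ρ A + if A = A₀ then c else 0) 𝒱 =
      polymerPartitionFunction inc' ρ 𝒱 +
        c * polymerPartitionFunction inc' ρ (𝒱.filter fun A => ¬ inc' A₀ A) := by
  have hsymm : ∀ γ γ' : Q, inc' γ γ' → inc' γ' γ := inc_symm_of_symm
  have hfilter : (𝒱.erase A₀).filter (fun A => ¬ inc' A₀ A) = 𝒱.filter fun A => ¬ inc' A₀ A := by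
    ext A
    simp only [Finset.mem_filter, Finset.mem_erase]
    constructor
    · rintro ⟨⟨-, hA⟩, h⟩; exact ⟨hA, h⟩
    · rintro ⟨hA, h⟩
      exact ⟨⟨fun hAA => h (by rw [hAA]; exact Std.Refl.refl A₀), hA⟩, h⟩
  have hoff : ∀ A ∈ 𝒱.erase A₀, (ρ A + if A = A₀ then c else 0) = ρ A := by
    intro A hA
    rw [if_neg (Finset.mem_erase.1 hA).1, add_zero]
  have hoff' : ∀ A ∈ (𝒱.erase A₀).filter (fun A => ¬ inc' A₀ A), (ρ A + if A = A₀ then c else 0) = ρ A :=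
    fun A hA => hoff A (Finset.mem_filter.1 hA).1
  rw [polymerPartitionFunction_eq_erase_add hsymm _ hA₀, polymerPartitionFunction_eq_erase_add hsymm ρ hA₀,
    polymerPartitionFunction_congr hoff, polymerPartitionFunction_congr hoff', if_pos rfl, hfilter]
  ring

/-- **Pushforward of a polymer gas along a support map.** Let `s : P → Q`, and suppose that
on the volume `B` (i) two polymers with the same image are incompatible, and (ii) two polymers
with different images are incompatible iff their images are (`inc'` reflexive and symmetric,
`inc` symmetric). Then `Ξ_B(w) = Ξ_{s(B)}(s_* w)`. [cite: Ueltschi1999, §2.3 (regrouping the expansion into polymers 𝒜 with weights ρ(𝒜))] -/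
theorem polymerPartitionFunction_pushforward [Std.Symm inc] [Std.Refl inc'] [Std.Symm inc']
    (s : P → Q) (w : P → ℂ) (B : Finset P)
    (hfib : ∀ X ∈ B, ∀ Y ∈ B, s X = s Y → inc X Y)
    (hinc : ∀ X ∈ B, ∀ Y ∈ B, s X ≠ s Y → (inc X Y ↔ inc' (s X) (s Y))) :
    polymerPartitionFunction inc w B =
      polymerPartitionFunction inc' (pushforwardActivity s w B) (B.image s) := by
  have hsymm : ∀ γ γ' : P, inc γ γ' → inc γ' γ := inc_symm_of_symm
  have hsymm' : ∀ γ γ' : Q, inc' γ γ' → inc' γ' γ := inc_symm_of_symm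
  induction B using Finset.strongInduction with
  | H B ih =>
    rcases B.eq_empty_or_nonempty with rfl | ⟨X₀, hX₀⟩
    · simp
    set B₀ := B.erase X₀ with hB₀
    have hX₀B₀ : X₀ ∉ B₀ := Finset.notMem_erase X₀ B
    have hB : B = insert X₀ B₀ := (Finset.insert_erase hX₀).symm
    have hB₀B : B₀ ⊂ B := Finset.erase_ssubset hX₀
    set A₀ := s X₀ with hA₀
    -- the compatible part of `B₀` and its image
    set B' := B₀.filter (fun Y => ¬ inc X₀ Y) with hB'
    have hB'B : B' ⊂ B := (Finset.filter_subset _ _).trans_ssubset hB₀B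
    set 𝒱₀ := B₀.image s with h𝒱₀
    -- restricted hypotheses
    have hfib₀ : ∀ X ∈ B₀, ∀ Y ∈ B₀, s X = s Y → inc X Y :=
      fun X hX Y hY => hfib X (hB₀B.subset hX) Y (hB₀B.subset hY)
    have hinc₀ : ∀ X ∈ B₀, ∀ Y ∈ B₀, s X ≠ s Y → (inc X Y ↔ inc' (s X) (s Y)) :=
      fun X hX Y hY => hinc X (hB₀B.subset hX) Y (hB₀B.subset hY)
    have hfib' : ∀ X ∈ B', ∀ Y ∈ B', s X = s Y → inc X Y :=
      fun X hX Y hY => hfib X (hB'B.subset hX) Y (hB'B.subset hY)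
    have hinc'' : ∀ X ∈ B', ∀ Y ∈ B', s X ≠ s Y → (inc X Y ↔ inc' (s X) (s Y)) :=
      fun X hX Y hY => hinc X (hB'B.subset hX) Y (hB'B.subset hY)
    -- `Y ∈ B₀` is compatible with `X₀` iff its image is compatible with `A₀`
    have hcompat : ∀ Y ∈ B₀, (¬ inc X₀ Y ↔ ¬ inc' A₀ (s Y)) := by
      intro Y hY
      have hYB : Y ∈ B := hB₀B.subset hY
      by_cases hsY : s X₀ = s Y
      · have h1 : inc X₀ Y := hfib X₀ hX₀ Y hYB hsY
        have h2 : inc' A₀ (s Y) := by rw [hA₀, hsY]; exact Std.Refl.refl _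
        exact ⟨fun h => absurd h1 h, fun h => absurd h2 h⟩
      · exact not_congr (hinc X₀ hX₀ Y hYB hsY)
    -- image of `B'`
    have himage : B'.image s = 𝒱₀.filter (fun A => ¬ inc' A₀ A) := by
      ext A
      simp only [Finset.mem_image, Finset.mem_filter, hB', h𝒱₀]
      constructor
      · rintro ⟨Y, ⟨hY, hYc⟩, rfl⟩
        exact ⟨⟨Y, hY, rfl⟩, (hcompat Y hY).1 hYc⟩
      · rintro ⟨⟨Y, hY, rfl⟩, hA⟩
        exact ⟨Y, ⟨hY, (hcompat Y hY).2 hA⟩, rfl⟩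
    -- the activities of `B'` and `B₀` agree on the image of `B'`
    have hact : ∀ A ∈ B'.image s, pushforwardActivity s w B' A = pushforwardActivity s w B₀ A := by
      intro A hA
      rw [himage, Finset.mem_filter] at hA
      rw [pushforwardActivity_apply, pushforwardActivity_apply, hB', Finset.filter_filter]
      refine Finset.sum_congr ?_ fun _ _ => rfl
      ext Y
      simp only [Finset.mem_filter]
      constructor
      · rintro ⟨hY, -, hYA⟩; exact ⟨hY, hYA⟩
      · rintro ⟨hY, hYA⟩
        exact ⟨hY, (hcompat Y hY).2 (hYA ▸ hA.2), hYA⟩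
    -- recursion on the left
    rw [polymerPartitionFunction_eq_erase_add hsymm w hX₀, ← hB₀, ← hB']
    rw [ih B₀ hB₀B hfib₀ hinc₀, ih B' hB'B hfib' hinc'', polymerPartitionFunction_congr hact, himage]
    -- the right-hand side: split off the activity of `X₀`
    have hvol : B.image s = insert A₀ 𝒱₀ := by rw [hB, Finset.image_insert]
    have hρ : pushforwardActivity s w B = fun A => pushforwardActivity s w B₀ A + if A = A₀ then w X₀ else 0 := by
      funext A
      rw [hB, pushforwardActivity_insert s w hX₀B₀]
    rw [hvol, hρ, polymerPartitionFunction_add_single _ _ (Finset.mem_insert_self A₀ 𝒱₀)]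
    -- `Ξ_{insert A₀ 𝒱₀}(ρ_{B₀}) = Ξ_{𝒱₀}(ρ_{B₀})` and the filters agree
    have hfilt : (insert A₀ 𝒱₀).filter (fun A => ¬ inc' A₀ A) = 𝒱₀.filter (fun A => ¬ inc' A₀ A) := by
      rw [Finset.filter_insert, if_neg (fun h => h (Std.Refl.refl A₀))]
    have hins : polymerPartitionFunction inc' (pushforwardActivity s w B₀) (insert A₀ 𝒱₀) =
        polymerPartitionFunction inc' (pushforwardActivity s w B₀) 𝒱₀ := by
      by_cases hmem : A₀ ∈ 𝒱₀
      · rw [Finset.insert_eq_of_mem hmem]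
      · rw [polymerPartitionFunction_eq_erase_of_eq_zero (inc := inc')
          (pushforwardActivity_eq_zero_of_not_mem_image hmem) (insert A₀ 𝒱₀), Finset.erase_insert hmem]
    rw [hfilt, hins]

end Pushforward

/-! ### Multiplicative set functions are polymer gases of connected components -/

section Multiplicative

variable {V : Type*} [DecidableEq V] {R : V → V → Prop}

/-- A set function multiplicative over non-touching unions is the product of its values over any
compatible (pairwise non-touching) family. [cite: FriedliVelenik2017, §5.2 (the weight factorises over components)] -/
theorem eq_prod_of_isCompatible_geomInc (M : Finset V → ℂ) (hM1 : M ∅ = 1)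
    (hM : ∀ K₁ K₂ : Finset V, ¬ Touches R K₁ K₂ → M (K₁ ∪ K₂) = M K₁ * M K₂)
    {𝒳 : Finset (Finset V)} (h𝒳 : IsCompatible (GeomInc R) 𝒳) :
    M (𝒳.biUnion id) = ∏ X ∈ 𝒳, M X := by
  induction 𝒳 using Finset.induction_on with
  | empty => simp [hM1]
  | @insert X₀ 𝒳 hX₀ ih =>
    have h𝒳' : IsCompatible (GeomInc R) 𝒳 := h𝒳.mono (Finset.subset_insert _ _)
    rw [Finset.biUnion_insert, Finset.prod_insert hX₀, id, ← ih h𝒳']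
    refine hM X₀ _ ?_
    rintro ⟨w, hw, q, hq, hwq⟩
    obtain ⟨X, hX, hqX⟩ := Finset.mem_biUnion.1 hq
    have hne : X₀ ≠ X := fun h => hX₀ (h ▸ hX)
    exact h𝒳 (Finset.mem_coe.2 (Finset.mem_insert_self X₀ 𝒳))
      (Finset.mem_coe.2 (Finset.mem_insert_of_mem hX)) hne (Or.inr ⟨w, hw, q, hqX, hwq⟩)

/-- **A multiplicative set function is the product of its values on the `R`-components.**
[cite: FriedliVelenik2017, §5.2 (the weight factorises over components)] -/
theorem eq_prod_rcomponents_of_forall_not_touches (hR : ∀ x y, R x y → R y x) (M : Finset V → ℂ)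
    (hM1 : M ∅ = 1) (hM : ∀ K₁ K₂ : Finset V, ¬ Touches R K₁ K₂ → M (K₁ ∪ K₂) = M K₁ * M K₂)
    (Q : Finset V) : M Q = ∏ X ∈ rcomponents R Q, M X := by
  conv_lhs => rw [← biUnion_rcomponents (R := R) Q]
  exact eq_prod_of_isCompatible_geomInc M hM1 hM (isCompatible_rcomponents hR Q)

/-- **Polymer representation of a multiplicative set function**: `Σ_{Q ⊆ P'} M Q` is the
partition function of the gas of `R`-connected subsets of `P'` with activity `M` and the
geometric incompatibility. [cite: FriedliVelenik2017, §5.2 (polymer representation)] -/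
theorem sum_powerset_eq_polymerPartitionFunction_of_mul (hR : ∀ x y, R x y → R y x) [DecidableRel R]
    (M : Finset V → ℂ) (hM1 : M ∅ = 1)
    (hM : ∀ K₁ K₂ : Finset V, ¬ Touches R K₁ K₂ → M (K₁ ∪ K₂) = M K₁ * M K₂) (P' : Finset V) :
    ∑ Q ∈ P'.powerset, M Q =
      polymerPartitionFunction (GeomInc R) M
        (by classical exact P'.powerset.filter fun X => IsRConnected R X) := by
  rw [← sum_powerset_prod_rcomponents hR P' M]
  exact Finset.sum_congr rfl fun Q _ => eq_prod_rcomponents_of_forall_not_touches hR M hM1 hM Q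

end Multiplicative

/-! ### Cells with vertex sets: from connected cell sets to subset polymers -/

section Cells

variable {V α : Type*} [DecidableEq α] (verts : V → Finset α)

/-- The support (set of vertices) of a finite set of cells. [cite: Ueltschi1999, §2.3 (𝒜 = ∪ A_i)] -/
def cellSupp (K : Finset V) : Finset α := K.biUnion verts

/-- Two cells share a vertex. [folklore] -/
def ShareVertex (b b' : V) : Prop := (verts b ∩ verts b').Nonempty

/-- `ShareVertex` is decidable. [folklore] -/
instance instDecidableRelShareVertex : DecidableRel (ShareVertex verts) := fun b b' => by
  unfold ShareVertex; infer_instance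

variable {verts}

/-- Membership in the support. [folklore] -/
theorem mem_cellSupp {K : Finset V} {x : α} : x ∈ cellSupp verts K ↔ ∃ b ∈ K, x ∈ verts b := by
  simp [cellSupp]

/-- `ShareVertex` is symmetric. [folklore] -/
theorem shareVertex_symm (b b' : V) (h : ShareVertex verts b b') : ShareVertex verts b' b := by
  unfold ShareVertex at h ⊢; rwa [Finset.inter_comm]

/-- The support is monotone. [folklore] -/
theorem cellSupp_mono {K₁ K₂ : Finset V} (h : K₁ ⊆ K₂) : cellSupp verts K₁ ⊆ cellSupp verts K₂ :=
  Finset.biUnion_subset_biUnion_of_subset_left _ h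

/-- The support of `∅`. [folklore] -/
@[simp] theorem cellSupp_empty : cellSupp verts (∅ : Finset V) = ∅ := by simp [cellSupp]

/-- A nonempty cell set whose cells have nonempty vertex sets has nonempty support. [folklore] -/
theorem cellSupp_nonempty (hne : ∀ b, (verts b).Nonempty) {K : Finset V} (hK : K.Nonempty) :
    (cellSupp verts K).Nonempty := by
  obtain ⟨b, hb⟩ := hK
  obtain ⟨x, hx⟩ := hne b
  exact ⟨x, mem_cellSupp.2 ⟨b, hb, hx⟩⟩

/-- **Touching (for "sharing a vertex") is meeting of supports.** [folklore] -/
theorem touches_shareVertex_iff (hne : ∀ b, (verts b).Nonempty) {K₁ K₂ : Finset V} :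
    Touches (ShareVertex verts) K₁ K₂ ↔ (cellSupp verts K₁ ∩ cellSupp verts K₂).Nonempty := by
  constructor
  · rintro ⟨w, hw, q, hq, rfl | ⟨x, hx⟩⟩
    · obtain ⟨x, hx⟩ := hne w
      exact ⟨x, Finset.mem_inter.2 ⟨mem_cellSupp.2 ⟨w, hw, hx⟩, mem_cellSupp.2 ⟨w, hq, hx⟩⟩⟩
    · exact ⟨x, Finset.mem_inter.2 ⟨mem_cellSupp.2 ⟨w, hw, (Finset.mem_inter.1 hx).1⟩,
        mem_cellSupp.2 ⟨q, hq, (Finset.mem_inter.1 hx).2⟩⟩⟩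
  · rintro ⟨x, hx⟩
    obtain ⟨h1, h2⟩ := Finset.mem_inter.1 hx
    obtain ⟨w, hw, hxw⟩ := mem_cellSupp.1 h1
    obtain ⟨q, hq, hxq⟩ := mem_cellSupp.1 h2
    exact ⟨w, hw, q, hq, Or.inr ⟨x, Finset.mem_inter.2 ⟨hxw, hxq⟩⟩⟩

/-- Non-touching cell sets have disjoint supports. [folklore] -/
theorem disjoint_cellSupp_of_not_touches (hne : ∀ b, (verts b).Nonempty) {K₁ K₂ : Finset V}
    (h : ¬ Touches (ShareVertex verts) K₁ K₂) : Disjoint (cellSupp verts K₁) (cellSupp verts K₂) := by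
  rw [touches_shareVertex_iff hne, Finset.not_nonempty_iff_eq_empty] at h
  exact Finset.disjoint_iff_inter_eq_empty.2 h

/-- The fibres of the support map over nonempty cell sets are cliques for the geometric
incompatibility. [folklore] -/
theorem geomInc_of_cellSupp_eq (hne : ∀ b, (verts b).Nonempty) {X Y : Finset V} (hX : X.Nonempty)
    (h : cellSupp verts X = cellSupp verts Y) : GeomInc (ShareVertex verts) X Y := by
  refine Or.inr ((touches_shareVertex_iff hne).2 ?_)
  rw [← h, Finset.inter_self]
  exact cellSupp_nonempty hne hX

/-- For cell sets with different supports, geometric incompatibility is the meet-or-equal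
incompatibility of the supports. [folklore] -/
theorem geomInc_iff_polyInc_cellSupp (hne : ∀ b, (verts b).Nonempty) {X Y : Finset V}
    (h : cellSupp verts X ≠ cellSupp verts Y) :
    GeomInc (ShareVertex verts) X Y ↔ polyInc (cellSupp verts X) (cellSupp verts Y) := by
  constructor
  · rintro (rfl | ht)
    · exact absurd rfl h
    · exact Or.inr ((touches_shareVertex_iff hne).1 ht)
  · rintro (he | hi)
    · exact absurd he h
    · exact Or.inr ((touches_shareVertex_iff hne).2 hi)

/-- The `ShareVertex`-connected (nonempty) subsets of the cell set `P'` — the polymers of the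
cell gas (classically decidable predicate). [cite: Ueltschi1999, §2.3 (connected families of interaction sets)] -/
def connectedCellSets (verts : V → Finset α) (P' : Finset V) : Finset (Finset V) :=
  by classical exact P'.powerset.filter fun X => IsRConnected (ShareVertex verts) X

/-- Membership in `connectedCellSets`. [folklore] -/
theorem mem_connectedCellSets {P' : Finset V} {X : Finset V} :
    X ∈ connectedCellSets verts P' ↔ X ⊆ P' ∧ IsRConnected (ShareVertex verts) X := by
  classical
  unfold connectedCellSets
  rw [Finset.mem_filter, Finset.mem_powerset]

/-- `connectedCellSets` is the volume appearing in `sum_powerset_eq_polymerPartitionFunction_of_mul`.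
[folklore] -/
theorem connectedCellSets_eq (P' : Finset V) :
    connectedCellSets verts P' =
      (by classical exact P'.powerset.filter fun X => IsRConnected (ShareVertex verts) X) := rfl

variable [DecidableEq V]

/-- The support of a union. [folklore] -/
theorem cellSupp_union (K₁ K₂ : Finset V) : cellSupp verts (K₁ ∪ K₂) = cellSupp verts K₁ ∪ cellSupp verts K₂ := by
  unfold cellSupp; rw [Finset.union_biUnion]

/-- **From connected cell sets to subset polymers**: the gas of `ShareVertex`-connected cell sets
in `𝒱` (geometric incompatibility) has the same partition function as the gas of their supports
with the meet-or-equal incompatibility and the pushed-forward activities. [cite: Ueltschi1999, §2.3 (polymers 𝒜 = supports of connected families, weights ρ(𝒜))] -/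
theorem polymerPartitionFunction_connected_eq_pushforward (hne : ∀ b, (verts b).Nonempty)
    (M : Finset V → ℂ) {𝒱 : Finset (Finset V)} (h𝒱 : ∀ X ∈ 𝒱, X.Nonempty) :
    polymerPartitionFunction (GeomInc (ShareVertex verts)) M 𝒱 =
      polymerPartitionFunction polyInc (pushforwardActivity (cellSupp verts) M 𝒱) (𝒱.image (cellSupp verts)) := by
  haveI : Std.Symm (GeomInc (ShareVertex verts)) := ⟨fun X Y h => geomInc_symm _ shareVertex_symm h⟩
  exact polymerPartitionFunction_pushforward (cellSupp verts) M 𝒱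
    (fun X hX Y _ h => geomInc_of_cellSupp_eq hne (h𝒱 X hX) h)
    (fun X _ Y _ h => geomInc_iff_polyInc_cellSupp hne h)

/-- **The full regrouping**: for a set function `M` on cell sets with `M ∅ = 1`, multiplicative
over unions of cell sets that share no vertex, `Σ_{Q ⊆ P'} M Q` is the partition function of the
subset polymers `A ⊆ α` with the meet-or-equal incompatibility and the activities
`ρ(A) = Σ_{X ⊆ P' connected, supp X = A} M X`. [cite: Ueltschi1999, §2.3 (eq. for Tr e^{-βH} as a polymer partition function)] -/
theorem sum_powerset_eq_polymerPartitionFunction_cellSupp (hne : ∀ b, (verts b).Nonempty)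
    (M : Finset V → ℂ) (hM1 : M ∅ = 1)
    (hM : ∀ K₁ K₂ : Finset V, Disjoint (cellSupp verts K₁) (cellSupp verts K₂) → M (K₁ ∪ K₂) = M K₁ * M K₂)
    (P' : Finset V) :
    ∑ Q ∈ P'.powerset, M Q =
      polymerPartitionFunction polyInc
        (pushforwardActivity (cellSupp verts) M (connectedCellSets verts P'))
        ((connectedCellSets verts P').image (cellSupp verts)) := by
  rw [sum_powerset_eq_polymerPartitionFunction_of_mul (shareVertex_symm) M hM1
    (fun K₁ K₂ h => hM K₁ K₂ (disjoint_cellSupp_of_not_touches hne h)) P']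
  exact polymerPartitionFunction_connected_eq_pushforward hne M
    fun X hX => (mem_connectedCellSets.1 hX).2.1

omit [DecidableEq V] in
/-- The pushed-forward activity of a set `A` of vertices only involves connected cell sets with
support exactly `A`; in particular it vanishes unless `A` is the support of a
`ShareVertex`-connected subset of `P'`. [folklore] -/
theorem pushforwardActivity_cellSupp_eq_zero {M : Finset V → ℂ} {P' : Finset V} {A : Finset α}
    (hA : ∀ X ⊆ P', IsRConnected (ShareVertex verts) X → cellSupp verts X ≠ A) :
    pushforwardActivity (cellSupp verts) M (connectedCellSets verts P') A = 0 := by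
  apply pushforwardActivity_eq_zero_of_not_mem_image
  intro h
  obtain ⟨X, hX, hXA⟩ := Finset.mem_image.1 h
  exact hA X (mem_connectedCellSets.1 hX).1 (mem_connectedCellSets.1 hX).2 hXA

end Cells

/-! ### Transport along embeddings of cells and vertices -/

section Transport

variable {V V' : Type*} {R : V → V → Prop} {R' : V' → V' → Prop}

/-- `R`-connectedness is transported along an injective map intertwining the relations.
[folklore] -/
theorem isRConnected_map_iff (f : V ↪ V') (hR : ∀ a b, R' (f a) (f b) ↔ R a b) (X : Finset V) :
    IsRConnected R' (X.map f) ↔ IsRConnected R X := by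
  unfold IsRConnected
  constructor
  · rintro ⟨hne, h⟩
    have hneX : X.Nonempty := Finset.map_nonempty.1 hne
    haveI : Nonempty V := ⟨hneX.choose⟩
    obtain ⟨g, hg⟩ := f.injective.hasLeftInverse
    have key : ∀ a' b', Relation.ReflTransGen (fun x y => R' x y ∧ x ∈ X.map f ∧ y ∈ X.map f) a' b' →
        Relation.ReflTransGen (fun x y => R x y ∧ x ∈ X ∧ y ∈ X) (g a') (g b') := by
      intro a' b' hab
      induction hab with
      | refl => exact Relation.ReflTransGen.refl
      | @tail c d _ hcd ih =>
        obtain ⟨hR', hc, hd⟩ := hcd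
        obtain ⟨c₀, hc₀, rfl⟩ := Finset.mem_map.1 hc
        obtain ⟨d₀, hd₀, rfl⟩ := Finset.mem_map.1 hd
        refine ih.tail ?_
        rw [hg c₀, hg d₀]
        exact ⟨(hR c₀ d₀).1 hR', hc₀, hd₀⟩
    refine ⟨hneX, fun v hv w hw => ?_⟩
    have := key (f v) (f w) (h (f v) (Finset.mem_map_of_mem f hv) (f w) (Finset.mem_map_of_mem f hw))
    rwa [hg v, hg w] at this
  · rintro ⟨hne, h⟩
    refine ⟨hne.map, fun v' hv' w' hw' => ?_⟩
    obtain ⟨v, hv, rfl⟩ := Finset.mem_map.1 hv'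
    obtain ⟨w, hw, rfl⟩ := Finset.mem_map.1 hw'
    exact Relation.ReflTransGen.lift f
      (fun a b hab => (⟨(hR a b).2 hab.1, Finset.mem_map_of_mem f hab.2.1, Finset.mem_map_of_mem f hab.2.2⟩ :
        R' (f a) (f b) ∧ f a ∈ X.map f ∧ f b ∈ X.map f)) v w (h v hv w hw)

variable {α α' : Type*} [DecidableEq α] [DecidableEq α']
variable {verts : V → Finset α} {verts' : V' → Finset α'} {f : V ↪ V'} {φ : α ↪ α'}

/-- Sharing a vertex is transported along compatible embeddings of cells and vertices. [folklore] -/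
theorem shareVertex_map_iff (hverts : ∀ b, verts' (f b) = (verts b).map φ) (a b : V) :
    ShareVertex verts' (f a) (f b) ↔ ShareVertex verts a b := by
  unfold ShareVertex
  rw [hverts, hverts, ← Finset.map_inter, Finset.map_nonempty]

/-- The support of the image is the image of the support. [folklore] -/
theorem cellSupp_map (hverts : ∀ b, verts' (f b) = (verts b).map φ) (X : Finset V) :
    cellSupp verts' (X.map f) = (cellSupp verts X).map φ := by
  ext x'
  simp only [mem_cellSupp, Finset.mem_map]
  constructor
  · rintro ⟨b', ⟨b, hb, rfl⟩, hx'⟩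
    rw [hverts, Finset.mem_map] at hx'
    obtain ⟨x, hx, rfl⟩ := hx'
    exact ⟨x, ⟨b, hb, hx⟩, rfl⟩
  · rintro ⟨x, ⟨b, hb, hx⟩, rfl⟩
    exact ⟨f b, ⟨b, hb, rfl⟩, by rw [hverts]; exact Finset.mem_map_of_mem φ hx⟩

/-- Connectedness of cell sets is transported. [folklore] -/
theorem isRConnected_shareVertex_map_iff (hverts : ∀ b, verts' (f b) = (verts b).map φ) (X : Finset V) :
    IsRConnected (ShareVertex verts') (X.map f) ↔ IsRConnected (ShareVertex verts) X :=
  isRConnected_map_iff f (shareVertex_map_iff hverts) X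

/-- **Transport of the pushed-forward activity.** If every connected cell set of `P'` with support
`φ(A)` is the image of a subset of `P`, `f(P) ⊆ P'`, and the set function `M'` restricts to `M`
along `f`, then the pushed-forward activities of `φ(A)` (computed in `P'`) and of `A` (computed in
`P`) agree. This is the volume independence / translation covariance of polymer weights defined
by connected families of interaction terms. [cite: Ueltschi1999, §2.3 (ρ(𝒜) only involves the sites of 𝒜; periodic weights)] -/
theorem pushforwardActivity_connectedCellSets_map (hverts : ∀ b, verts' (f b) = (verts b).map φ)
    {P : Finset V} {P' : Finset V'} {M : Finset V → ℂ} {M' : Finset V' → ℂ} (A : Finset α)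
    (hPP' : P.map f ⊆ P')
    (hfib : ∀ X' ⊆ P', IsRConnected (ShareVertex verts') X' → cellSupp verts' X' = A.map φ → ∃ X ⊆ P, X.map f = X')
    (hM : ∀ X ⊆ P, M' (X.map f) = M X) :
    pushforwardActivity (cellSupp verts') M' (connectedCellSets verts' P') (A.map φ) =
      pushforwardActivity (cellSupp verts) M (connectedCellSets verts P) A := by
  rw [pushforwardActivity_apply, pushforwardActivity_apply]
  symm
  refine Finset.sum_bij (fun X _ => X.map f) ?_ ?_ ?_ ?_
  · intro X hX
    obtain ⟨hX, hXA⟩ := Finset.mem_filter.1 hX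
    obtain ⟨hXP, hXc⟩ := mem_connectedCellSets.1 hX
    refine Finset.mem_filter.2 ⟨mem_connectedCellSets.2 ⟨(Finset.map_subset_map.2 hXP).trans hPP', ?_⟩, ?_⟩
    · exact (isRConnected_shareVertex_map_iff hverts X).2 hXc
    · rw [cellSupp_map hverts, hXA]
  · intro X _ Y _ h
    exact Finset.map_injective f h
  · intro X' hX'
    obtain ⟨hX', hX'A⟩ := Finset.mem_filter.1 hX'
    obtain ⟨hX'P, hX'c⟩ := mem_connectedCellSets.1 hX'
    obtain ⟨X, hXP, rfl⟩ := hfib X' hX'P hX'c hX'A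
    refine ⟨X, Finset.mem_filter.2 ⟨mem_connectedCellSets.2 ⟨hXP, ?_⟩, ?_⟩, rfl⟩
    · exact (isRConnected_shareVertex_map_iff hverts X).1 hX'c
    · apply Finset.map_injective φ
      rw [← cellSupp_map hverts, hX'A]
  · intro X hX
    exact (hM X (mem_connectedCellSets.1 (Finset.mem_filter.1 hX).1).1).symm

end Transport

/-! ### Enlarging the volume by polymers of zero activity -/

section ZeroActivity

variable {P : Type*} [DecidableEq P] {inc : P → P → Prop} [DecidableRel inc]

/-- Polymers of zero activity may be added to or removed from the volume. [folklore] -/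
theorem polymerPartitionFunction_eq_of_subset_of_eq_zero [Std.Symm inc] {w : P → ℂ} {𝒱 𝒱' : Finset P}
    (h : 𝒱 ⊆ 𝒱') (h0 : ∀ γ ∈ 𝒱', γ ∉ 𝒱 → w γ = 0) :
    polymerPartitionFunction inc w 𝒱' = polymerPartitionFunction inc w 𝒱 := by
  induction 𝒱' using Finset.strongInduction with
  | H 𝒱' ih =>
    by_cases heq : 𝒱' = 𝒱
    · rw [heq]
    · obtain ⟨γ, hγ', hγ⟩ : ∃ γ ∈ 𝒱', γ ∉ 𝒱 := by
        by_contra hno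
        push Not at hno
        exact heq (Finset.Subset.antisymm hno h)
      rw [polymerPartitionFunction_eq_erase_of_eq_zero (inc := inc) (h0 γ hγ' hγ) 𝒱']
      refine ih (𝒱'.erase γ) (Finset.erase_ssubset hγ') (fun δ hδ => ?_) fun δ hδ hδ𝒱 => ?_
      · exact Finset.mem_erase.2 ⟨fun hδγ => hγ (hδγ ▸ hδ), h hδ⟩
      · exact h0 δ (Finset.mem_of_mem_erase hδ) hδ𝒱

end ZeroActivity

end Literature.Probability.LatticeModels

end
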